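import Summits.QuantumFields.BalabanUV.T4Continuum.Support.ShellMeasureBandCount

/-!
# `T4Continuum.ShellMeasureRootComposition` — NE7c ROOT COMPOSITION, END-I (measure level): `ShellWeightBound` from
# the two runs' SLOT DATA, the per-slot anti-concentration (M1) BY LEVEL, the live window (W1) and the width rate —
# ONE kernel theorem, every located input a displayed binder
# (cell `pub-balaban`, sub-cell `t4`, spine estimate NE7c (node U5b); lineage t4-ne7c-p1 = PROVER seat P1
# «shell-measure route», generation 26; row S7a of the crew claim table `t4/b2b-balaban-t4-ne7c-p1/LEAVES-NE7c-P1.md`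
# under `t4/T4-NE7c-TRIGGER.json` condition c1 «S7 FIRST»; ADDITIVE — imports road P2's `ShellMeasureBandCount`
# (p207307; hence `T4ShellMeasureLevels` p190827, `T4ShellMeasure` p185315, `T4ShellCount`) only; 0 `def`, 0 sorry)

HONEST FRAMING.  Finite four-torus programme, rung (B)+1 only — NOT infinite volume, NOT a mass gap, NOT the Clay
problem, NOT summit progress; (B), `BetaPertHyp`, (B^μ) not consumed (they sit upstream of the term families, by
name).  NE7c = `T4IndicatorShell.ShellWeightBound` is NOT PRINTED in [Balaban 1983–89] and NOT PROVED: this file is the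
COMPOSITION «NE7c ⇐ the named binders» (trigger c3) and asserts none of them.  The binders displayed below are, per run:
the READING (R) of the expansion B14 (2.18) as nonnegative terms with per-slot shell pieces and its [dict] PUSH to a
realized positive measure per slot (the slot's own indicator removed) — `sh_nonneg`/`sh_le`/`cover`/`piece_le`/`total_ge`;
THE WALL (M1) = `T4ShellMeasure.SlotAntiConcentration` PER SLOT, BY LEVEL (binder `hac`; GAPS G-ne7cp1-1) — supplied at
level 0 by `ShellMeasureWilsonRealizedSU2.slotAntiConcentration_wilson_su2` (p206694) /
`ShellMeasureWilsonGaugeInvariant.slotAntiConcentration_wilson_su2_gaugeInvariant`, and at a live level `j ≥ 1` by END-II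
(row S7b) = `ShellMeasureHeadlines.slotAntiConcentration_realized_su2_gaugeInvariant` ∘ `T4ShellMeasureDet` transports ∘
`ShellMeasureLevelAssembly.slotAntiConcentration_of_levelData` (p206468), whose binders ARE the skeleton's SM-L1…L6
((AN-bound)_j, (SM)_j, graded words, non-Wilson ray bound, (LR), (MR) — located, NOT PRINTED as numbers); the live
WINDOW (W1) + slot count (SM-L7, `T4ShellMeasureLevels.LiveWindow`; produced from the torus cube count by road P2's
`ShellMeasureBandCount.liveWindow_of_cubeCount`); the uniform constant bound `D_j ≤ D̄` (SM-L10 absorbed); and the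
WIDTH RATE `ρ_j ≤ c₁ϑ^j` (SM-L8 — node U1b's two-run sup-closeness rate, BY NAME; trigger c4: no NE7c seat proves it)
or, in the `_band` twin, `Summable ρ` + age counts (road P2's head, trigger c6).  HONEST DEPENDENCY (cell): continuum
YM on T⁴ ⇐ BetaPertH ∧ nine spine estimates (0/9 proved); BetaPertH ⇐ (D1) ∧ (D4) ∧ CAP+tail; G-an2-4 gates asym, D1 and
NE2/3/4.

## What is proved (all [folklore] bookkeeping; no structure, no def — the binders are displayed arguments)

* §1 `levelLedger_of_slotAC`: ONE run — term family `A` with shell parts `sh` on `|t| ≤ l₀`, slots `S K` at levels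
  `lvl K s` with pieces `piece K t s`, realized finite measures `μ K t s` on configuration spaces `Ω K s` with tested
  variables `u K t s`, thresholds `θ_j`, widths `ρ_j`, constants `D_j`, [dict] proportionality constants `M K t s ≥ 0`;
  (R) + [dict] push + (M1) per slot ⇒ `T4ShellMeasureLevels.LevelLedger l₀ T A sh S piece lvl D ρ`
  (`T4ShellMeasure.slot_field_of_antiConcentration` per slot).
* §2 END-I `shellWeightBound_of_slotAC`: two runs (own slot types, spaces, levels, constants) + (W1) windows with a
  common depth `N₁` and count `ν̄` + `D ≤ D̄` + rate `ρ_j ≤ c₁ϑ^j`, `0 < ϑ < 1` ⇒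
  `ShellWeightBound l₀ T A B shA shB (K ↦ Σ_{s∈S^A K} D^A_{lvl s} ρ^A_{lvl s} + Σ_{s∈S^B K} D^B_{lvl s} ρ^B_{lvl s})`
  (`T4ShellMeasureLevels.shellWeightBound_of_levels`); `shellWeightBound_of_slotAC_band`: the same from `Summable ρ`
  and age counts `#{s ∈ S K : K − lvl s = a} ≤ m a` (`ShellMeasureBandCount.shellWeightBound_of_levels_band`, road P2).
* §3 `hybridNE7_tail_of_slotAC`: END-I through the seam (ζ′) socket — plus the NE7b half `RelWeightBound`, a
  `ReindexedBudget` on the hybrid cores and four summable producer rates ⇒ `∃ K₀`, `T4MatchingAssembly.HybridNE7` for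
  the shifted families (`T4ShellMeasureLevels.hybridNE7_tail_of_levels`).

WHAT THIS DOES NOT DO.  No binder is discharged; (M1) per slot is THE wall; NE7c NOT proved; 0/9 spine.
-/

open Finset MeasureTheory

namespace Summit.QuantumFields.BalabanUV.T4Continuum.ShellMeasureRootComposition

open Literature.MathematicalPhysics.QuantumFieldTheory.Balaban1983to89
open T4WeightBudget T4IndicatorShell T4MatchingAssembly T4MatchingClosure T4MatchingClosureSocket T4ShellMeasure
open T4ShellMeasureLevels (LevelLedger LiveWindow shellWeightBound_of_levels hybridNE7_tail_of_levels)
open ShellMeasureBandCount (shellWeightBound_of_levels_band)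

/-! ## §1 One run: the level ledger from slot data + (M1) per slot -/

section OneRun

variable {ι σ : Type*} {Ω : ℕ → σ → Type*} [∀ K s, MeasurableSpace (Ω K s)]
  {l₀ : ℝ} {T : ℕ → Finset ι} {A sh : ℕ → ℝ → ι → ℝ} {S : ℕ → Finset σ} {piece : ℕ → ℝ → σ → ι → ℝ}
  {lvl : ℕ → σ → ℕ} {μ : ∀ K : ℕ, ℝ → ∀ s : σ, Measure (Ω K s)} [∀ K t s, IsFiniteMeasure (μ K t s)]
  {u : ∀ K : ℕ, ℝ → ∀ s : σ, Ω K s → ℝ} {θ D ρ : ℕ → ℝ} {M : ℕ → ℝ → σ → ℝ}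

/-- **THE LEVEL LEDGER OF ONE RUN FROM SLOT DATA AND (M1) PER SLOT.**  DATA: terms `T K` with weights `A K t τ` and
shell parts `sh K t τ`; slots `S K` at levels `lvl K s` with per-slot shell pieces `piece K t s τ`; per slot a realized
FINITE positive measure `μ K t s` on `Ω K s` (the run's measure at source `t` with the slot's OWN indicator removed)
and the slot's tested variable `u K t s`; thresholds `θ_j`, widths `ρ_j ≥ 0`, constants `D_j ≥ 0`, [dict] constants
`M K t s ≥ 0`.  BINDERS: (R) `sh_nonneg`/`sh_le`/`cover`; [dict] PUSH `piece_le` (the slot's pieces weigh at most `M ×`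
the `μ`-mass of the slot's threshold shell `{θ_j(1−ρ_j) ≤ u < θ_j}`) and `total_ge` (`M ×` total mass `≤ Σ_τ A`); THE
WALL `hac` = (M1) per slot at its own level.  CONCLUSION: `LevelLedger l₀ T A sh S piece lvl D ρ`. [folklore] -/
theorem levelLedger_of_slotAC
    (sh_nonneg : ∀ K t, |t| ≤ l₀ → ∀ τ ∈ T K, 0 ≤ sh K t τ)
    (sh_le : ∀ K t, |t| ≤ l₀ → ∀ τ ∈ T K, sh K t τ ≤ A K t τ)
    (cover : ∀ K t, |t| ≤ l₀ → ∀ τ ∈ T K, sh K t τ ≤ ∑ s ∈ S K, piece K t s τ)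
    (hM : ∀ K t, |t| ≤ l₀ → ∀ s ∈ S K, 0 ≤ M K t s)
    (piece_le : ∀ K t, |t| ≤ l₀ → ∀ s ∈ S K, ∑ τ ∈ T K, piece K t s τ ≤ M K t s *
      (μ K t s {x | θ (lvl K s) * (1 - ρ (lvl K s)) ≤ u K t s x ∧ u K t s x < θ (lvl K s)}).toReal)
    (total_ge : ∀ K t, |t| ≤ l₀ → ∀ s ∈ S K, M K t s * (μ K t s Set.univ).toReal ≤ ∑ τ ∈ T K, A K t τ)
    (hD : ∀ j, 0 ≤ D j) (hρ : ∀ j, 0 ≤ ρ j)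
    (hac : ∀ K t, |t| ≤ l₀ → ∀ s ∈ S K,
      SlotAntiConcentration (μ K t s) (u K t s) (θ (lvl K s)) (ρ (lvl K s)) (D (lvl K s))) :
    LevelLedger l₀ T A sh S piece lvl D ρ where
  sh_nonneg := sh_nonneg
  sh_le := sh_le
  cover := cover
  slot K t ht s hs := slot_field_of_antiConcentration (hD _) (hρ _) (hac K t ht s hs) (T K) (hM K t ht s hs)
    (piece_le K t ht s hs) (total_ge K t ht s hs)
  D_nonneg := hD
  ρ_nonneg := hρ

end OneRun

/-! ## §2 END-I: two runs ⇒ `ShellWeightBound` -/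

section TwoRuns

variable {ι σ σ' : Type*} {ΩA : ℕ → σ → Type*} {ΩB : ℕ → σ' → Type*} [∀ K s, MeasurableSpace (ΩA K s)]
  [∀ K s, MeasurableSpace (ΩB K s)] {l₀ : ℝ} {T : ℕ → Finset ι} {A B shA shB : ℕ → ℝ → ι → ℝ}
  {SA : ℕ → Finset σ} {SB : ℕ → Finset σ'} {pieceA : ℕ → ℝ → σ → ι → ℝ} {pieceB : ℕ → ℝ → σ' → ι → ℝ}
  {lvlA : ℕ → σ → ℕ} {lvlB : ℕ → σ' → ℕ}
  {μA : ∀ K : ℕ, ℝ → ∀ s : σ, Measure (ΩA K s)} [∀ K t s, IsFiniteMeasure (μA K t s)]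
  {μB : ∀ K : ℕ, ℝ → ∀ s : σ', Measure (ΩB K s)} [∀ K t s, IsFiniteMeasure (μB K t s)]
  {uA : ∀ K : ℕ, ℝ → ∀ s : σ, ΩA K s → ℝ} {uB : ∀ K : ℕ, ℝ → ∀ s : σ', ΩB K s → ℝ}
  {θA DA ρA θB DB ρB : ℕ → ℝ} {MA : ℕ → ℝ → σ → ℝ} {MB : ℕ → ℝ → σ' → ℝ}
  {N₁ : ℕ} {νbar Dbar c₁ ϑ : ℝ} {m : ℕ → ℝ}

/-- **END-I — `ShellWeightBound` ⇐ THE NAMED BINDERS (trigger c1/c3).**  Per run X ∈ {A, B} the slot data and binders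
of `levelLedger_of_slotAC` ((R) + [dict] push + THE WALL (M1) per slot by level, `hacA`/`hacB`); then the live window
(W1) with slot count `hwA`/`hwB` (SM-L7), the uniform constant bound `D ≤ D̄` (SM-L10 absorbed) and the width rate
`ρ_j ≤ c₁ϑ^j`, `0 < ϑ < 1` (SM-L8, node U1b BY NAME — no NE7c seat proves it, c4).  CONCLUSION: LITERALLY
`T4IndicatorShell.ShellWeightBound l₀ T A B shA shB Wsh` with
`Wsh K = Σ_{s∈S^A K} D^A_{lvl s}·ρ^A_{lvl s} + Σ_{s∈S^B K} D^B_{lvl s}·ρ^B_{lvl s}` (summable, eventually small: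
`T4ShellMeasureLevels.omega_add_le`).  CONDITIONAL on every binder; nothing PRINTED is asserted. [folklore] -/
theorem shellWeightBound_of_slotAC
    -- run A: (R), [dict] push, (M1) per slot
    (sh_nonnegA : ∀ K t, |t| ≤ l₀ → ∀ τ ∈ T K, 0 ≤ shA K t τ)
    (sh_leA : ∀ K t, |t| ≤ l₀ → ∀ τ ∈ T K, shA K t τ ≤ A K t τ)
    (coverA : ∀ K t, |t| ≤ l₀ → ∀ τ ∈ T K, shA K t τ ≤ ∑ s ∈ SA K, pieceA K t s τ)
    (hMA : ∀ K t, |t| ≤ l₀ → ∀ s ∈ SA K, 0 ≤ MA K t s)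
    (piece_leA : ∀ K t, |t| ≤ l₀ → ∀ s ∈ SA K, ∑ τ ∈ T K, pieceA K t s τ ≤ MA K t s *
      (μA K t s {x | θA (lvlA K s) * (1 - ρA (lvlA K s)) ≤ uA K t s x ∧ uA K t s x < θA (lvlA K s)}).toReal)
    (total_geA : ∀ K t, |t| ≤ l₀ → ∀ s ∈ SA K, MA K t s * (μA K t s Set.univ).toReal ≤ ∑ τ ∈ T K, A K t τ)
    (hDA0 : ∀ j, 0 ≤ DA j) (hρA0 : ∀ j, 0 ≤ ρA j)
    (hacA : ∀ K t, |t| ≤ l₀ → ∀ s ∈ SA K,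
      SlotAntiConcentration (μA K t s) (uA K t s) (θA (lvlA K s)) (ρA (lvlA K s)) (DA (lvlA K s)))
    -- run B: (R), [dict] push, (M1) per slot
    (sh_nonnegB : ∀ K t, |t| ≤ l₀ → ∀ τ ∈ T K, 0 ≤ shB K t τ)
    (sh_leB : ∀ K t, |t| ≤ l₀ → ∀ τ ∈ T K, shB K t τ ≤ B K t τ)
    (coverB : ∀ K t, |t| ≤ l₀ → ∀ τ ∈ T K, shB K t τ ≤ ∑ s ∈ SB K, pieceB K t s τ)
    (hMB : ∀ K t, |t| ≤ l₀ → ∀ s ∈ SB K, 0 ≤ MB K t s)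
    (piece_leB : ∀ K t, |t| ≤ l₀ → ∀ s ∈ SB K, ∑ τ ∈ T K, pieceB K t s τ ≤ MB K t s *
      (μB K t s {x | θB (lvlB K s) * (1 - ρB (lvlB K s)) ≤ uB K t s x ∧ uB K t s x < θB (lvlB K s)}).toReal)
    (total_geB : ∀ K t, |t| ≤ l₀ → ∀ s ∈ SB K, MB K t s * (μB K t s Set.univ).toReal ≤ ∑ τ ∈ T K, B K t τ)
    (hDB0 : ∀ j, 0 ≤ DB j) (hρB0 : ∀ j, 0 ≤ ρB j)
    (hacB : ∀ K t, |t| ≤ l₀ → ∀ s ∈ SB K,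
      SlotAntiConcentration (μB K t s) (uB K t s) (θB (lvlB K s)) (ρB (lvlB K s)) (DB (lvlB K s)))
    -- (W1) windows + count, constant bound, rate
    (hwA : LiveWindow SA lvlA N₁ νbar) (hwB : LiveWindow SB lvlB N₁ νbar) (hϑ0 : 0 < ϑ) (hϑ1 : ϑ < 1)
    (hDA : ∀ j, DA j ≤ Dbar) (hDB : ∀ j, DB j ≤ Dbar)
    (hrateA : ∀ j, ρA j ≤ c₁ * ϑ ^ j) (hrateB : ∀ j, ρB j ≤ c₁ * ϑ ^ j) :
    ShellWeightBound l₀ T A B shA shB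
      (fun K => ∑ s ∈ SA K, DA (lvlA K s) * ρA (lvlA K s) + ∑ s ∈ SB K, DB (lvlB K s) * ρB (lvlB K s)) :=
  shellWeightBound_of_levels
    (levelLedger_of_slotAC sh_nonnegA sh_leA coverA hMA piece_leA total_geA hDA0 hρA0 hacA)
    (levelLedger_of_slotAC sh_nonnegB sh_leB coverB hMB piece_leB total_geB hDB0 hρB0 hacB)
    hwA hwB hϑ0 hϑ1 hDA hDB hrateA hrateB

/-- **END-I, BAND TWIN (road P2's head, trigger c6).**  The same conclusion from `Summable ρ^A`, `Summable ρ^B` and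
age-resolved slot counts `#{s ∈ S K : K − lvl s = a} ≤ m a` (`a ≤ N₁`) in place of the geometric rate —
`ShellMeasureBandCount.shellWeightBound_of_levels_band` (p207307). [folklore] -/
theorem shellWeightBound_of_slotAC_band
    (sh_nonnegA : ∀ K t, |t| ≤ l₀ → ∀ τ ∈ T K, 0 ≤ shA K t τ)
    (sh_leA : ∀ K t, |t| ≤ l₀ → ∀ τ ∈ T K, shA K t τ ≤ A K t τ)
    (coverA : ∀ K t, |t| ≤ l₀ → ∀ τ ∈ T K, shA K t τ ≤ ∑ s ∈ SA K, pieceA K t s τ)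
    (hMA : ∀ K t, |t| ≤ l₀ → ∀ s ∈ SA K, 0 ≤ MA K t s)
    (piece_leA : ∀ K t, |t| ≤ l₀ → ∀ s ∈ SA K, ∑ τ ∈ T K, pieceA K t s τ ≤ MA K t s *
      (μA K t s {x | θA (lvlA K s) * (1 - ρA (lvlA K s)) ≤ uA K t s x ∧ uA K t s x < θA (lvlA K s)}).toReal)
    (total_geA : ∀ K t, |t| ≤ l₀ → ∀ s ∈ SA K, MA K t s * (μA K t s Set.univ).toReal ≤ ∑ τ ∈ T K, A K t τ)
    (hDA0 : ∀ j, 0 ≤ DA j) (hρA0 : ∀ j, 0 ≤ ρA j)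
    (hacA : ∀ K t, |t| ≤ l₀ → ∀ s ∈ SA K,
      SlotAntiConcentration (μA K t s) (uA K t s) (θA (lvlA K s)) (ρA (lvlA K s)) (DA (lvlA K s)))
    (sh_nonnegB : ∀ K t, |t| ≤ l₀ → ∀ τ ∈ T K, 0 ≤ shB K t τ)
    (sh_leB : ∀ K t, |t| ≤ l₀ → ∀ τ ∈ T K, shB K t τ ≤ B K t τ)
    (coverB : ∀ K t, |t| ≤ l₀ → ∀ τ ∈ T K, shB K t τ ≤ ∑ s ∈ SB K, pieceB K t s τ)
    (hMB : ∀ K t, |t| ≤ l₀ → ∀ s ∈ SB K, 0 ≤ MB K t s)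
    (piece_leB : ∀ K t, |t| ≤ l₀ → ∀ s ∈ SB K, ∑ τ ∈ T K, pieceB K t s τ ≤ MB K t s *
      (μB K t s {x | θB (lvlB K s) * (1 - ρB (lvlB K s)) ≤ uB K t s x ∧ uB K t s x < θB (lvlB K s)}).toReal)
    (total_geB : ∀ K t, |t| ≤ l₀ → ∀ s ∈ SB K, MB K t s * (μB K t s Set.univ).toReal ≤ ∑ τ ∈ T K, B K t τ)
    (hDB0 : ∀ j, 0 ≤ DB j) (hρB0 : ∀ j, 0 ≤ ρB j)
    (hacB : ∀ K t, |t| ≤ l₀ → ∀ s ∈ SB K,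
      SlotAntiConcentration (μB K t s) (uB K t s) (θB (lvlB K s)) (ρB (lvlB K s)) (DB (lvlB K s)))
    (hwA : LiveWindow SA lvlA N₁ νbar) (hwB : LiveWindow SB lvlB N₁ νbar)
    (hDA : ∀ j, DA j ≤ Dbar) (hDB : ∀ j, DB j ≤ Dbar)
    (hmA : ∀ K, ∀ a ≤ N₁, (((SA K).filter fun s => K - lvlA K s = a).card : ℝ) ≤ m a)
    (hmB : ∀ K, ∀ a ≤ N₁, (((SB K).filter fun s => K - lvlB K s = a).card : ℝ) ≤ m a)
    (hρA : Summable ρA) (hρB : Summable ρB) :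
    ShellWeightBound l₀ T A B shA shB
      (fun K => ∑ s ∈ SA K, DA (lvlA K s) * ρA (lvlA K s) + ∑ s ∈ SB K, DB (lvlB K s) * ρB (lvlB K s)) :=
  shellWeightBound_of_levels_band
    (levelLedger_of_slotAC sh_nonnegA sh_leA coverA hMA piece_leA total_geA hDA0 hρA0 hacA)
    (levelLedger_of_slotAC sh_nonnegB sh_leB coverB hMB piece_leB total_geB hDB0 hρB0 hacB)
    hwA hwB hDA hDB hmA hmB hρA hρB

/-! ## §3 Through the seam (ζ′) socket -/

/-- **END-I THROUGH THE SEAM (ζ′).**  The binders of `shellWeightBound_of_slotAC` PLUS the NE7b half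
`RelWeightBound … Bad W`, a `ReindexedBudget` on the hybrid cores `A − shA`, `B − shB` and four summable producer rates
⇒ an origin `K₀` with `T4MatchingAssembly.HybridNE7` for the `K₀`-shifted families, shell weight = END-I's `Wsh`,
remainder rate `(r + u) + (s + s₂)` (`T4ShellMeasureLevels.hybridNE7_tail_of_levels`). [folklore] -/
theorem hybridNE7_tail_of_slotAC [DecidableEq ι] {vol : ℝ} {Bad : ℕ → ℝ → Finset ι}
    {Cc Rr CcRec RrRec : ℕ → ℝ → ι → ℝ} {ν u' s₂ c₀ r s' W : ℕ → ℝ}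
    (sh_nonnegA : ∀ K t, |t| ≤ l₀ → ∀ τ ∈ T K, 0 ≤ shA K t τ)
    (sh_leA : ∀ K t, |t| ≤ l₀ → ∀ τ ∈ T K, shA K t τ ≤ A K t τ)
    (coverA : ∀ K t, |t| ≤ l₀ → ∀ τ ∈ T K, shA K t τ ≤ ∑ s ∈ SA K, pieceA K t s τ)
    (hMA : ∀ K t, |t| ≤ l₀ → ∀ s ∈ SA K, 0 ≤ MA K t s)
    (piece_leA : ∀ K t, |t| ≤ l₀ → ∀ s ∈ SA K, ∑ τ ∈ T K, pieceA K t s τ ≤ MA K t s *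
      (μA K t s {x | θA (lvlA K s) * (1 - ρA (lvlA K s)) ≤ uA K t s x ∧ uA K t s x < θA (lvlA K s)}).toReal)
    (total_geA : ∀ K t, |t| ≤ l₀ → ∀ s ∈ SA K, MA K t s * (μA K t s Set.univ).toReal ≤ ∑ τ ∈ T K, A K t τ)
    (hDA0 : ∀ j, 0 ≤ DA j) (hρA0 : ∀ j, 0 ≤ ρA j)
    (hacA : ∀ K t, |t| ≤ l₀ → ∀ s ∈ SA K,
      SlotAntiConcentration (μA K t s) (uA K t s) (θA (lvlA K s)) (ρA (lvlA K s)) (DA (lvlA K s)))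
    (sh_nonnegB : ∀ K t, |t| ≤ l₀ → ∀ τ ∈ T K, 0 ≤ shB K t τ)
    (sh_leB : ∀ K t, |t| ≤ l₀ → ∀ τ ∈ T K, shB K t τ ≤ B K t τ)
    (coverB : ∀ K t, |t| ≤ l₀ → ∀ τ ∈ T K, shB K t τ ≤ ∑ s ∈ SB K, pieceB K t s τ)
    (hMB : ∀ K t, |t| ≤ l₀ → ∀ s ∈ SB K, 0 ≤ MB K t s)
    (piece_leB : ∀ K t, |t| ≤ l₀ → ∀ s ∈ SB K, ∑ τ ∈ T K, pieceB K t s τ ≤ MB K t s *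
      (μB K t s {x | θB (lvlB K s) * (1 - ρB (lvlB K s)) ≤ uB K t s x ∧ uB K t s x < θB (lvlB K s)}).toReal)
    (total_geB : ∀ K t, |t| ≤ l₀ → ∀ s ∈ SB K, MB K t s * (μB K t s Set.univ).toReal ≤ ∑ τ ∈ T K, B K t τ)
    (hDB0 : ∀ j, 0 ≤ DB j) (hρB0 : ∀ j, 0 ≤ ρB j)
    (hacB : ∀ K t, |t| ≤ l₀ → ∀ s ∈ SB K,
      SlotAntiConcentration (μB K t s) (uB K t s) (θB (lvlB K s)) (ρB (lvlB K s)) (DB (lvlB K s)))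
    (hwA : LiveWindow SA lvlA N₁ νbar) (hwB : LiveWindow SB lvlB N₁ νbar) (hϑ0 : 0 < ϑ) (hϑ1 : ϑ < 1)
    (hDA : ∀ j, DA j ≤ Dbar) (hDB : ∀ j, DB j ≤ Dbar)
    (hrateA : ∀ j, ρA j ≤ c₁ * ϑ ^ j) (hrateB : ∀ j, ρB j ≤ c₁ * ϑ ^ j)
    -- the NE7b half, the budget on the hybrid cores, the producer rates
    (hW : RelWeightBound l₀ T A B Bad W)
    (hTB : ReindexedBudget l₀ vol T (fun K t τ => A K t τ - shA K t τ) (fun K t τ => B K t τ - shB K t τ) Bad Cc Rr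
      CcRec RrRec ν u' s₂ c₀ r s')
    (hr : Summable r) (hu : Summable u') (hs : Summable s') (hs₂ : Summable s₂) :
    ∃ K₀, HybridNE7 l₀ vol (fun K => T (K₀ + K)) (fun K => A (K₀ + K)) (fun K => B (K₀ + K)) (fun K => Bad (K₀ + K))
      (fun K => W (K₀ + K)) (fun K => shA (K₀ + K)) (fun K => shB (K₀ + K))
      (fun K => ∑ s ∈ SA (K₀ + K), DA (lvlA (K₀ + K) s) * ρA (lvlA (K₀ + K) s) +
        ∑ s ∈ SB (K₀ + K), DB (lvlB (K₀ + K) s) * ρB (lvlB (K₀ + K) s))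
      (fun K => (r (K₀ + K) + u' (K₀ + K)) + (s' (K₀ + K) + s₂ (K₀ + K))) :=
  hybridNE7_tail_of_levels
    (levelLedger_of_slotAC sh_nonnegA sh_leA coverA hMA piece_leA total_geA hDA0 hρA0 hacA)
    (levelLedger_of_slotAC sh_nonnegB sh_leB coverB hMB piece_leB total_geB hDB0 hρB0 hacB)
    hwA hwB hϑ0 hϑ1 hDA hDB hrateA hrateB hW hTB hr hu hs hs₂

end TwoRuns

end Summit.QuantumFields.BalabanUV.T4Continuum.ShellMeasureRootComposition
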